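import Mathlib
import Summits.ABC.ABC.Theorems.ThreeSlotZooSquareRung

/-!
# The square–square rung of the three-slot cyclotomic descent (second BC5 witness)

The common-exponent-`2` member of the zoo crux `CyclotomicZooABC` (route-ABC-ThreeSlotCyclotomicDescent):
three-prime abc triples `p^(2u) + q^y = r^(2m)` (`p ≠ q` primes, `r` prime, `u, m, y ≥ 1`), i.e. `a` and
`c` both perfect squares.  The descent `q^y = (r^m - p^u)(r^m + p^u)` plus Mihăilescu's theorem
(`mihailescu_holds`) and two `mod 3` twin lemmas give the COMPLETE list
`(4,5,9), (16,9,25), (64,17,81), (9,7,16), (9,16,25), (49,32,81)` (the last is the E-3SLOT champion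
`32 + 49 = 81`, quality `1.1757`), hence the ε-free abc inequality `c ≤ 2 · rad(abc)` on this family.
-/

namespace Summit.ABC.ABC.Theorems.ThreeSlotZooSquareSquare

open Literature.NumberTheory.DiophantineGeometry UniqueFactorizationMonoid
open Summit.ABC.ABC.Theorems.ThreeSlotZooSquareRung

/-- `2^(2k) ≡ 1 (mod 3)`. -/
theorem two_pow_even_mod_three (k : ℕ) : 2 ^ (2 * k) % 3 = 1 := by
  rw [pow_mul]; norm_num [Nat.pow_mod]

/-- `2^(2k+1) ≡ 2 (mod 3)`. -/
theorem two_pow_odd_mod_three (k : ℕ) : 2 ^ (2 * k + 1) % 3 = 2 := by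
  rw [pow_succ, pow_mul]; norm_num [Nat.mul_mod, Nat.pow_mod]

/-- A prime divisible by `3` is `3`. -/
theorem eq_three_of_prime_of_three_dvd {p : ℕ} (hp : p.Prime) (h : 3 ∣ p) : p = 3 :=
  ((hp.eq_one_or_self_of_dvd 3 h).resolve_left (by norm_num)).symm

/-- Twin lemma 1: `2^k - 1` and `2^k + 1` both prime forces `k = 2`. -/
theorem twin_around_two_pow {p r k : ℕ} (hp : p.Prime) (hr : r.Prime) (h1 : p + 1 = 2 ^ k)
    (h2 : r = 2 ^ k + 1) : k = 2 := by
  rcases Nat.even_or_odd k with ⟨j, hj⟩ | ⟨j, hj⟩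
  · have hk : k = 2 * j := by omega
    have hmod := two_pow_even_mod_three j
    rw [← hk] at hmod
    have h3 : 3 ∣ p := by omega
    have := eq_three_of_prime_of_three_dvd hp h3
    subst this
    have h4 : 2 ^ k = 4 := by omega
    have := Nat.pow_right_injective (le_refl 2) (show 2 ^ k = 2 ^ 2 by rw [h4])
    exact this
  · have hmod := two_pow_odd_mod_three j
    rw [← hj] at hmod
    have h3 : 3 ∣ r := by omega
    have := eq_three_of_prime_of_three_dvd hr h3
    subst this
    have h4 : 2 ^ k = 2 := by omega
    have hk1 : k = 1 := by
      have := Nat.pow_right_injective (le_refl 2) (show 2 ^ k = 2 ^ 1 by rw [h4])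
      exact this
    subst hk1
    have hp1 : p = 1 := by omega
    exact absurd hp1 hp.one_lt.ne'

/-- Twin lemma 2: `2^u + 1` and `2^(u+1) + 1` both prime forces `u = 1` (for `u ≥ 1`). -/
theorem fermat_neighbours {r q u : ℕ} (hr : r.Prime) (hq : q.Prime) (hu : 1 ≤ u) (h1 : r = 2 ^ u + 1)
    (h2 : q = 2 ^ (u + 1) + 1) : u = 1 := by
  rcases Nat.even_or_odd u with ⟨j, hj⟩ | ⟨j, hj⟩
  · have hk : u + 1 = 2 * j + 1 := by omega
    have hmod := two_pow_odd_mod_three j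
    rw [← hk] at hmod
    have h3 : 3 ∣ q := by omega
    have := eq_three_of_prime_of_three_dvd hq h3
    subst this
    have h4 : 2 ^ (u + 1) = 2 := by omega
    have := Nat.pow_right_injective (le_refl 2) (show 2 ^ (u + 1) = 2 ^ 1 by rw [h4])
    omega
  · have hmod := two_pow_odd_mod_three j
    rw [← hj] at hmod
    have h3 : 3 ∣ r := by omega
    have := eq_three_of_prime_of_three_dvd hr h3
    subst this
    have h4 : 2 ^ u = 2 := by omega
    exact Nat.pow_right_injective (le_refl 2) (show 2 ^ u = 2 ^ 1 by rw [h4])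

/-- Twin lemma 3: `2^m - 1` and `2^(m+1) - 1` both prime forces `m = 2`. -/
theorem mersenne_neighbours {p q m : ℕ} (hp : p.Prime) (hq : q.Prime) (h1 : p + 1 = 2 ^ m)
    (h2 : q + 1 = 2 ^ (m + 1)) : m = 2 := by
  rcases Nat.even_or_odd m with ⟨j, hj⟩ | ⟨j, hj⟩
  · have hk : m = 2 * j := by omega
    have hmod := two_pow_even_mod_three j
    rw [← hk] at hmod
    have h3 : 3 ∣ p := by omega
    have := eq_three_of_prime_of_three_dvd hp h3
    subst this
    have h4 : 2 ^ m = 4 := by omega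
    exact Nat.pow_right_injective (le_refl 2) (show 2 ^ m = 2 ^ 2 by rw [h4])
  · have hk : m + 1 = 2 * (j + 1) := by omega
    have hmod := two_pow_even_mod_three (j + 1)
    rw [← hk] at hmod
    have h3 : 3 ∣ q := by omega
    have := eq_three_of_prime_of_three_dvd hq h3
    subst this
    have h4 : 2 ^ (m + 1) = 4 := by omega
    have := Nat.pow_right_injective (le_refl 2) (show 2 ^ (m + 1) = 2 ^ 2 by rw [h4])
    have hm1 : m = 1 := by omega
    subst hm1
    have : p = 1 := by omega
    exact absurd this hp.one_lt.ne'

/-- Three pairwise distinct primes dividing `n ≠ 0` multiply to a divisor of `radical n`. -/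
theorem mul_dvd_radical {p q r n : ℕ} (hp : p.Prime) (hq : q.Prime) (hr : r.Prime) (hpq : p ≠ q)
    (hpr : p ≠ r) (hqr : q ≠ r) (hn : n ≠ 0) (hpn : p ∣ n) (hqn : q ∣ n) (hrn : r ∣ n) :
    p * q * r ∣ radical n := by
  have h1 : p ∣ radical n := (dvd_radical_iff_of_irreducible hp hn).mpr hpn
  have h2 : q ∣ radical n := (dvd_radical_iff_of_irreducible hq hn).mpr hqn
  have h3 : r ∣ radical n := (dvd_radical_iff_of_irreducible hr hn).mpr hrn
  have c12 : Nat.Coprime p q := (Nat.coprime_primes hp hq).mpr hpq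
  have c13 : Nat.Coprime p r := (Nat.coprime_primes hp hr).mpr hpr
  have c23 : Nat.Coprime q r := (Nat.coprime_primes hq hr).mpr hqr
  exact (Nat.Coprime.mul_left c13 c23).mul_dvd_of_dvd_of_dvd (c12.mul_dvd_of_dvd_of_dvd h1 h2) h3

/-- The structural core: the six solutions, in the form of the bound `c ≤ 2·p·q·r`. -/
theorem core {p q r u m y : ℕ} (hp : p.Prime) (hq : q.Prime) (hr : r.Prime) (hpq : p ≠ q)
    (hu : 1 ≤ u) (hm : 1 ≤ m) (hy : 1 ≤ y) (h : p ^ (2 * u) + q ^ y = r ^ (2 * m)) :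
    r ^ (2 * m) ≤ 2 * (p * q * r) := by
  have hA2 : p ^ (2 * u) = (p ^ u) ^ 2 := by rw [← pow_mul, mul_comm]
  have hR2 : r ^ (2 * m) = (r ^ m) ^ 2 := by rw [← pow_mul, mul_comm]
  rw [hR2]
  rw [hA2, hR2] at h
  set A := p ^ u with hA
  set R := r ^ m with hR
  have hA1 : 2 ≤ A := le_trans hp.two_le (Nat.le_self_pow (by omega) p)
  have hR1 : 2 ≤ R := le_trans hr.two_le (Nat.le_self_pow (by omega) r)
  have hqy : 1 ≤ q ^ y := Nat.one_le_pow _ _ hq.pos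
  have hAR : A < R := by nlinarith
  obtain ⟨d, hd⟩ := Nat.exists_eq_add_of_lt hAR
  -- e = R - A ≥ 1
  obtain ⟨e, he1, hRe⟩ : ∃ e, 1 ≤ e ∧ R = A + e := ⟨d + 1, by omega, by omega⟩
  have hqe : q ^ y = e * (2 * A + e) := by
    have h' : (A + e) ^ 2 = A ^ 2 + e * (2 * A + e) := by ring
    rw [hRe, h'] at h; omega
  by_cases hq2 : q = 2
  · -- q = 2 : e = 2, p^u + 1 = 2^k, r^m = 2^k + 1
    subst hq2
    have hp2 : p ≠ 2 := hpq
    have hpodd : Odd p := hp.eq_two_or_odd'.resolve_left hp2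
    have hAodd : Odd A := by rw [hA]; exact hpodd.pow
    obtain ⟨i, -, hei⟩ := (Nat.dvd_prime_pow Nat.prime_two).mp (⟨2 * A + e, hqe⟩ : e ∣ 2 ^ y)
    obtain ⟨j, -, hfj⟩ :=
      (Nat.dvd_prime_pow Nat.prime_two).mp (⟨e, by rw [hqe]; ring⟩ : 2 * A + e ∣ 2 ^ y)
    -- i = 1
    have hi : i = 1 := by
      rcases i with _ | _ | i
      · -- e = 1 : 2A + 1 = 2^j is odd, so j = 0, absurd
        exfalso
        have he : e = 1 := by simpa using hei
        rw [he] at hfj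
        rcases j with _ | j
        · simp at hfj; omega
        · have : 2 ∣ 2 ^ (j + 1) := dvd_pow_self 2 (by omega)
          rw [← hfj] at this; omega
      · rfl
      · -- 4 ∣ e : then 2A + e ≡ 2 (mod 4) is a power of two ≥ 5, absurd
        exfalso
        have h4e : 4 ∣ e := ⟨2 ^ i, by rw [hei]; ring⟩
        obtain ⟨a0, ha0⟩ := hAodd
        rcases j with _ | _ | j
        · simp at hfj; omega
        · simp at hfj; omega
        · have h4f : 4 ∣ 2 ^ (j + 2) := ⟨2 ^ j, by ring⟩
          rw [← hfj] at h4f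
          omega
    subst hi
    have he2 : e = 2 := by simpa using hei
    subst he2
    -- 2A + 2 = 2^j with j ≥ 1 : A + 1 = 2^k
    obtain ⟨k, rfl⟩ : ∃ k, j = k + 1 := by
      rcases j with _ | j
      · simp at hfj
      · exact ⟨j, rfl⟩
    have hAk : 2 ^ k = A + 1 := by
      have : 2 ^ (k + 1) = 2 * 2 ^ k := by ring
      omega
    have hRk : R = 2 ^ k + 1 := by omega
    -- u = 1 by Catalan-lite A
    have hu1 : u = 1 := by
      by_contra hu1
      exact pow_add_one_ne_two_pow hp.two_le (by omega : 2 ≤ u) (m := k) (by rw [hAk])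
    subst hu1
    simp only [pow_one] at hA
    -- A = p now (definitionally via `set`); case on m
    rcases Nat.lt_or_ge m 2 with hm1 | hm2
    · have hm1' : m = 1 := by omega
      subst hm1'
      simp only [pow_one] at hR
      -- p + 1 = 2^k and r = 2^k + 1 both prime ⇒ k = 2
      have hk2 := twin_around_two_pow hp hr (k := k) (by rw [hAk, hA]) (by rw [← hRk, hR])
      subst hk2
      have hp3 : p = 3 := by
        have : A = 3 := by
          have : (2 : ℕ) ^ 2 = 4 := by norm_num
          omega
        simpa [hA] using this
      have hr5 : r = 5 := by
        have : R = 5 := by rw [hRk]; norm_num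
        simpa [hR] using this
      subst hp3 hr5
      norm_num [hR]
    · obtain ⟨hr3, hm2', hk3⟩ := pow_eq_two_pow_add_one hr.two_le hm2 (m := k) (by rw [← hRk])
      subst hr3 hm2' hk3
      have hp7 : p = 7 := by
        have : A = 7 := by
          have : (2 : ℕ) ^ 3 = 8 := by norm_num
          omega
        simpa [hA] using this
      subst hp7
      norm_num [hR]
  · -- q odd : e = 1, r^m = p^u + 1, q^y = 2 p^u + 1
    have hqA : ¬ q ∣ A := by
      intro hqA
      rw [hA] at hqA
      exact hpq ((Nat.prime_dvd_prime_iff_eq hq hp).mp (hq.dvd_of_dvd_pow hqA)).symm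
    have hqy_dvd : q ^ y ∣ e * (2 * A + e) := ⟨1, by rw [hqe]; ring⟩
    have he_one : e = 1 := by
      by_cases hqediv : q ∣ e
      · -- then q ∤ 2A + e, so q^y ∣ e, forcing 2A + e = 1: absurd
        exfalso
        have hqf : ¬ q ∣ 2 * A + e := by
          intro hqf
          have hq2A : q ∣ 2 * A := by
            have := (Nat.dvd_add_right hqediv).mp (by rw [add_comm] at hqf; exact hqf)
            exact this
          have hq2' : ¬ q ∣ 2 := by
            intro hq2'
            have := (Nat.prime_dvd_prime_iff_eq hq Nat.prime_two).mp hq2'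
            exact hq2 this
          have := (Nat.Prime.dvd_mul hq).mp hq2A
          rcases this with h2 | hA'
          · exact hq2' h2
          · exact hqA hA'
        have hcop : Nat.Coprime (q ^ y) (2 * A + e) := (hq.coprime_iff_not_dvd.mpr hqf).pow_left y
        obtain ⟨t, ht⟩ : q ^ y ∣ e := hcop.dvd_of_dvd_mul_right hqy_dvd
        have hqpos : 0 < q ^ y := pow_pos hq.pos y
        have : q ^ y * 1 = q ^ y * (t * (2 * A + e)) := by
          calc q ^ y * 1 = q ^ y := mul_one _
            _ = e * (2 * A + e) := hqe
            _ = q ^ y * (t * (2 * A + e)) := by rw [ht]; ring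
        have h1 := Nat.eq_of_mul_eq_mul_left hqpos this
        have : 2 * A + e ∣ 1 := ⟨t, by rw [h1]; ring⟩
        have := Nat.le_of_dvd one_pos this
        omega
      · have hcop : Nat.Coprime (q ^ y) e := (hq.coprime_iff_not_dvd.mpr hqediv).pow_left y
        obtain ⟨t, ht⟩ : q ^ y ∣ 2 * A + e := hcop.dvd_of_dvd_mul_left hqy_dvd
        have hqpos : 0 < q ^ y := pow_pos hq.pos y
        have : q ^ y * 1 = q ^ y * (e * t) := by
          calc q ^ y * 1 = q ^ y := mul_one _
            _ = e * (2 * A + e) := hqe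
            _ = q ^ y * (e * t) := by rw [ht]; ring
        have h1 := Nat.eq_of_mul_eq_mul_left hqpos this
        have : e ∣ 1 := ⟨t, h1⟩
        exact Nat.dvd_one.mp this
    subst he_one
    -- now R = A + 1 and q^y = 2A + 1
    have hqA' : q ^ y = 2 * A + 1 := by omega
    rcases Nat.lt_or_ge m 2 with hm1 | hm2
    · -- m = 1 : r = p^u + 1, so p = 2, r = 2^u + 1, q^y = 2^(u+1) + 1
      have hm1' : m = 1 := by omega
      subst hm1'
      simp only [pow_one] at hR
      have hp2 : p = 2 := by
        by_contra hp2
        have hpodd : Odd p := hp.eq_two_or_odd'.resolve_left hp2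
        have hAodd : Odd A := by rw [hA]; exact hpodd.pow
        have hReven : Even R := by
          obtain ⟨a0, ha0⟩ := hAodd; exact ⟨a0 + 1, by omega⟩
        have hReven' : Even r := by simpa [hR] using hReven
        have hr2 : r = 2 := (hr.even_iff).mp hReven'
        have : R = 2 := by simp [hR, hr2]
        omega
      subst hp2
      have hr' : r = 2 ^ u + 1 := by
        have : R = 2 ^ u + 1 := by rw [hRe, hA]
        simpa [hR] using this
      have hq' : q ^ y = 2 ^ (u + 1) + 1 := by rw [hqA', hA]; ring
      rcases Nat.lt_or_ge y 2 with hy1 | hy2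
      · have hy1' : y = 1 := by omega
        subst hy1'
        rw [pow_one] at hq'
        have hu1 := fermat_neighbours hr hq hu hr' hq'
        subst hu1
        have hr3 : r = 3 := by rw [hr']; norm_num
        have hq5 : q = 5 := by rw [hq']; norm_num
        subst hr3 hq5
        norm_num [hR]
      · obtain ⟨hq3, hy2', hu3⟩ := pow_eq_two_pow_add_one hq.two_le hy2 hq'
        have hu2 : u = 2 := by omega
        subst hq3 hy2' hu2
        have hr5 : r = 5 := by rw [hr']; norm_num
        subst hr5
        norm_num [hR]
    · rcases Nat.lt_or_ge u 2 with hu1 | hu2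
      · -- u = 1, m ≥ 2 : r^m = p + 1, so r = 2, p = 2^m - 1, q^y = 2^(m+1) - 1
        have hu1' : u = 1 := by omega
        subst hu1'
        simp only [pow_one] at hA
        have hr2 : r = 2 := by
          by_contra hr2
          have hrodd : Odd r := hr.eq_two_or_odd'.resolve_left hr2
          have hRodd : Odd R := by rw [hR]; exact hrodd.pow
          have hAeven : Even A := by
            obtain ⟨r0, hr0⟩ := hRodd; exact ⟨r0, by omega⟩
          have hpeven : Even p := by simpa [hA] using hAeven
          have hp2 : p = 2 := (hp.even_iff).mp hpeven
          -- then R = 3 = r^m with m ≥ 2: absurd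
          have hR3 : R = 3 := by rw [hRe]; simp [hA, hp2]
          have : r ^ m = 3 := by rw [← hR3]
          have hr3 : 3 ≤ r := by
            rcases hrodd with ⟨r0, hr0⟩; have := hr.two_le; omega
          have : r ^ 2 ≤ r ^ m := Nat.pow_le_pow_right hr.pos hm2
          nlinarith
        subst hr2
        have hpm : p + 1 = 2 ^ m := by
          have : R = A + 1 := hRe
          rw [hR] at this
          simp only [hA] at this ⊢
          omega
        rcases Nat.lt_or_ge y 2 with hy1 | hy2
        · have hy1' : y = 1 := by omega
          subst hy1'
          rw [pow_one] at hqA'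
          have hqm : q + 1 = 2 ^ (m + 1) := by
            rw [hqA', pow_succ]
            simp only [hA] at hpm ⊢
            omega
          have hm2' := mersenne_neighbours hp hq hpm hqm
          subst hm2'
          have hp3 : p = 3 := by
            have : (2 : ℕ) ^ 2 = 4 := by norm_num
            omega
          have hq7 : q = 7 := by
            have : (2 : ℕ) ^ 3 = 8 := by norm_num
            omega
          subst hp3 hq7
          norm_num [hR]
        · exfalso
          refine pow_add_one_ne_two_pow hq.two_le hy2 (m := m + 1) ?_
          rw [hqA', pow_succ]
          simp only [hA] at hpm ⊢
          omega
      · -- u, m ≥ 2 : Mihăilescu ⇒ r = 3, m = 2, p = 2, u = 3, q^y = 17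
        have hcat : R = A + 1 := hRe
        rw [hR, hA] at hcat
        obtain ⟨hr3, hm2', hp2, hu3⟩ := mihailescu_holds hp.pos hm2 hu2 hcat
        subst hr3 hm2' hp2 hu3
        have hq17 : q ^ y = 17 := by rw [hqA', hA]; norm_num
        obtain ⟨hq17', -⟩ := (Nat.Prime.pow_eq_iff (by norm_num : Nat.Prime 17)).mp hq17
        subst hq17'
        norm_num [hR]

/-- **The square–square rung**: ε-free abc with constant `2` on the three-prime triples
`p^(2u) + q^y = r^(2m)` (second certified special case of crux `CyclotomicZooABC`). -/
theorem squareSquareZoo : ∀ p q r u m y : ℕ, p.Prime → q.Prime → r.Prime → p ≠ q → 1 ≤ u → 1 ≤ m →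
    1 ≤ y → p ^ (2 * u) + q ^ y = r ^ (2 * m) →
    r ^ (2 * m) ≤ 2 * rad (p ^ (2 * u)) (q ^ y) (r ^ (2 * m)) := by
  intro p q r u m y hp hq hr hpq hu hm hy h
  have hcore := core hp hq hr hpq hu hm hy h
  have hp0 := hp.pos
  have hq0 := hq.pos
  have hr0 := hr.pos
  have hn0 : p ^ (2 * u) * q ^ y * r ^ (2 * m) ≠ 0 := by positivity
  have hpr : p ≠ r := by
    rintro rfl
    have h1 : p ∣ p ^ (2 * m) := dvd_pow_self p (by omega)
    rw [← h] at h1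
    have h2 : p ∣ q ^ y := (Nat.dvd_add_right (dvd_pow_self p (by omega))).mp h1
    exact hpq ((Nat.prime_dvd_prime_iff_eq hp hq).mp (hp.dvd_of_dvd_pow h2))
  have hqr : q ≠ r := by
    rintro rfl
    have h1 : q ∣ q ^ (2 * m) := dvd_pow_self q (by omega)
    rw [← h] at h1
    have h2 : q ∣ p ^ (2 * u) := (Nat.dvd_add_left (dvd_pow_self q (by omega))).mp h1
    exact hpq ((Nat.prime_dvd_prime_iff_eq hq hp).mp (hq.dvd_of_dvd_pow h2)).symm
  have hdvd : p * q * r ∣ radical (p ^ (2 * u) * q ^ y * r ^ (2 * m)) :=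
    mul_dvd_radical hp hq hr hpq hpr hqr hn0
      (Dvd.dvd.mul_right (Dvd.dvd.mul_right (dvd_pow_self p (by omega)) _) _)
      (Dvd.dvd.mul_right (Dvd.dvd.mul_left (dvd_pow_self q (by omega)) _) _)
      (Dvd.dvd.mul_left (dvd_pow_self r (by omega)) _)
  rw [rad_def]
  calc r ^ (2 * m) ≤ 2 * (p * q * r) := hcore
    _ ≤ 2 * radical (p ^ (2 * u) * q ^ y * r ^ (2 * m)) :=
        Nat.mul_le_mul_left 2 (Nat.le_of_dvd (Nat.pos_of_ne_zero radical_ne_zero) hdvd)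

end Summit.ABC.ABC.Theorems.ThreeSlotZooSquareSquare
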